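import Summits.QuantumFields.YangMills.Theorems.BalabanUVNodesN09PerBondChartsOfForwardLawsSharp
import Summits.QuantumFields.YangMills.Theorems.BalabanUVNodesN09CentralWindowForwardLawAtRecord

/-!
# NODE N09 [B12] — ROAD A′'s PER-BOND INVERSION DATA WITH ALL SIXTEEN CLAUSES, FROM NUMERICS ALONE (dag-n09-w4 g5's proved forward Jacobian laws ∘ this seat's sharp packaging)

Cell `pub-ymgap` (YM-PLAN Track A), width seat `pub-ymgap-dag-n09-w6` g4, FILE 5′; helper of K1⁹ `StabilityBRunRowsAtRecordR13SepCoPHV` = stmt-QuantumFields-27364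
(`--supports`, `--as helper`, count-neutral).  [I] = [Balaban1987RG1].  CONSUMED BY NAME (nothing modified): dag-n09-w4 g5's ★★★
`…N09CentralWindowForwardLawAtRecord.exists_jacobian_forwardLaws_continuousOn` ((F): the forward Jacobian laws of the one-variable (0.4) maps on the central `α`-windows with jointly measurable
densities non-vanishing on the windows, for EVERY bond and environment — PROVED there under `j+1 ≤ m+K`, `0 ≤ α ≤ 1∕24`, `64·α ≤ δ_N`, `157·α < L^{−(d−1)}`, `offCard∕|Idx| + 150·α < 1`)
and this seat's ★★★ `…N09PerBondChartsOfForwardLawsSharp.exists_perBondCharts_of_forwardLaws_sharp` (the sixteen-clause packaging from forward laws).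

WHAT.  One `obtain`: per level `j < K`, under the five numerics above, `∃ jac T ϑ jd` with `jac` jointly measurable, non-vanishing and FIBREWISE CONTINUOUS on the windows (dag-n09-w4's
four-clause `exists_jacobian_forwardLaws_continuousOn`, the fourth clause added on this seat's ask) and the SIXTEEN clauses — central windows measurable and blind, image-window graph measurable,
`ϑ`, `jd` jointly measurable, right inverse, inverse law, `T =` image window, left inverse, `ϑ ∈ Ωα` on `T`, (Q) `jd = (jac ∘ ϑ)⁻¹` for dag-n09-w4's density `jac`, (P) `jd ≠ 0` on `T`,
(C1) closed image graphs, (C2) joint continuity of every `ϑ_c`, (C3) joint continuity of the triangular chart, (C4) compact image windows — i.e. dag-n09-w4's `exists_perBondCharts_centralWindow`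
(ten clauses) SHARPENED by six, with NO forward-law hypothesis left — and a seventeenth, (J′) `∀ c U, ContinuousOn (jd c U) (T c U)` (FILE 4's `continuousOn_inverseDensity_of_formula`
on (Q) + the fourth clause): the tower's (C-jd) binder, from numerics alone.

HONEST FRAMING.  A COMPOSITION BY NAME, count-neutral; the numerics stay displayed; NO openness ((O), (O-int)), NO support clause, NO nullity here; nothing of
Bałaban's estimates asserted; `hreg` NOT discharged; N09 NOT discharged; conjunct 1 (Lemma 4) ∕ FLAG №7 untouched; K0⁷ ∕ K1⁹ ∕ K3⁸ NOT closed; counts unmoved (typed 28∕28 ·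
discharged 5∕28); no summit statement is proved by this seat; one finite four-torus programme at fixed `ε` — R4 closes the conditional rung `BalabanLadder.UV` only; NOT continuum ∕
ℝ⁴ ∕ OS; the Yang–Mills mass gap (Clay) is NOT proved by any of this.
-/

noncomputable section

open scoped Matrix.Norms.L2Operator

namespace Summit.QuantumFields.YangMills.BalabanUVNodes.N09PerBondChartsCentralWindowSharp

open MeasureTheory Set Function Filter Topology
open scoped ENNReal NNReal
open Literature.MathematicalPhysics.QuantumFieldTheory.Balaban1983to89
open Literature.MathematicalPhysics.QuantumFieldTheory.Balaban1983to89.T4Continuum (T4Family)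
open Literature.MathematicalPhysics.QuantumFieldTheory.Balaban1983to89.BlockAveraging (Idx)
open Literature.MathematicalPhysics.QuantumFieldTheory.Balaban1983to89.BlockAveragingHaarAC (centralBond pre post)
open Literature.MathematicalPhysics.QuantumFieldTheory.Balaban1983to89.BlockAveragingEMLHaarAC (fibreFamily offCard)
open Literature.MathematicalPhysics.QuantumFieldTheory.Balaban1983to89.ExpMeanLog (deltaSU deltaSU_pos)
open Literature.MathematicalPhysics.QuantumFieldTheory.Balaban1983to89.Node00
open Summit.QuantumFields.YangMills.BalabanUVNodes.N09PerBondChartsOfForwardLawsSharp (exists_perBondCharts_of_forwardLaws_sharp continuousOn_inverseDensity_of_formula)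
open Summit.QuantumFields.YangMills.BalabanUVNodes.N09CentralWindowForwardLawAtRecord (exists_jacobian_forwardLaws_continuousOn)
open Summit.QuantumFields.YangMills.BalabanUVNodes.N09LiftInvariance29AtRecord (succ_le_range_of_lt)

variable {F : T4Family} {N : ℕ} [NeZero N] {K j : ℕ}

/-- ★★★ **THE SIXTEEN-CLAUSE PER-BOND INVERSION DATA OF ROAD A′ AT LEVEL `j < K`, FROM NUMERICS ALONE** (`0 ≤ α ≤ 1∕24`, `64·α ≤ δ_N`, `157·α < L^{−(d−1)}`,
`offCard c∕|Idx| + 150·α < 1`): dag-n09-w4 g5's forward laws fed into this seat's sharp packaging; the `jac` of clause (Q) is dag-n09-w4's density.  CONDITIONAL on the numerics only;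
nothing of Bałaban's asserted.  Clauses: `hjacm`, `hjac0`, `hcont` (forward density), then the sixteen of FILE 4, then (J′). [cite: Balaban1987RG1, p.259, (0.4) p.253 and (2.9)–(2.10) pp.266–267; Kechris1995, Thm 15.1 and Cor 15.2; Helgason2000, Ch. I §1 Thm. 1.14 (12)-(13) p. 96; BourbakiGT1, Ch. I §10 no. 2, Thm 1 Cor. 5] -/
theorem exists_perBondCharts_centralWindow_sharp (hj : j < K) {α : ℝ} (hα0 : 0 ≤ α) (hα24 : α ≤ 1 / 24) (hα64 : 64 * α ≤ deltaSU (Fin N))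
    (hαL : 157 * α < ((((F.P K).L : ℝ)) ^ ((F.P K).d - 1))⁻¹)
    (hgap : ∀ c : PBond (F.P K) (j + 1), (offCard c : ℝ) / (Fintype.card (Idx (F.P K)) : ℝ) + 150 * α < 1) :
    ∃ (jac : PBond (F.P K) (j + 1) → GaugeField (F.P K) j (SU N) → SU N → ℝ≥0)
      (T : PBond (F.P K) (j + 1) → GaugeField (F.P K) j (SU N) → Set (SU N))
      (ϑ : PBond (F.P K) (j + 1) → GaugeField (F.P K) j (SU N) → SU N → SU N)
      (jd : PBond (F.P K) (j + 1) → GaugeField (F.P K) j (SU N) → SU N → ℝ≥0),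
      (∀ c, Measurable fun p : GaugeField (F.P K) j (SU N) × SU N => jac c p.1 p.2) ∧
      (∀ c U g, (∀ i : Idx (F.P K), dist1 (fibreFamily U c (pre U c * g * post U c) i) ≤ α) → jac c U g ≠ 0) ∧
      (∀ c U, ContinuousOn (jac c U) {g : SU N | ∀ i : Idx (F.P K), dist1 (fibreFamily U c (pre U c * g * post U c) i) ≤ α}) ∧
      (∀ c, MeasurableSet {p : GaugeField (F.P K) j (SU N) × SU N | p.2 ∈
          {g : SU N | ∀ i : Idx (F.P K), dist1 (fibreFamily p.1 c (pre p.1 c * g * post p.1 c) i) ≤ α}}) ∧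
      (∀ c (U : GaugeField (F.P K) j (SU N)) (g' : PBond (F.P K) (j + 1) → SU N),
          {g : SU N | ∀ i : Idx (F.P K), dist1 (fibreFamily (extend centralBond g' U) c
              (pre (extend centralBond g' U) c * g * post (extend centralBond g' U) c) i) ≤ α} =
            {g : SU N | ∀ i : Idx (F.P K), dist1 (fibreFamily U c (pre U c * g * post U c) i) ≤ α}) ∧
      (∀ c, MeasurableSet {p : GaugeField (F.P K) j (SU N) × SU N | p.2 ∈ T c p.1}) ∧
      (∀ c, Measurable fun p : GaugeField (F.P K) j (SU N) × SU N => ϑ c p.1 p.2) ∧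
      (∀ c, Measurable fun p : GaugeField (F.P K) j (SU N) × SU N => jd c p.1 p.2) ∧
      (∀ c U, ∀ v ∈ T c U, (avOfRecord F N K j).avg (Function.update U (centralBond c) (ϑ c U v)) c = v) ∧
      (∀ c U, (HaarData.haar : Measure (SU N)).restrict {g : SU N | ∀ i : Idx (F.P K), dist1 (fibreFamily U c (pre U c * g * post U c) i) ≤ α} =
        (((HaarData.haar : Measure (SU N)).restrict (T c U)).withDensity fun v => (jd c U v : ℝ≥0∞)).map (ϑ c U)) ∧
      (∀ c U, T c U = (fun g => (avOfRecord F N K j).avg (Function.update U (centralBond c) g) c) ''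
          {g : SU N | ∀ i : Idx (F.P K), dist1 (fibreFamily U c (pre U c * g * post U c) i) ≤ α}) ∧
      (∀ c U g, (∀ i : Idx (F.P K), dist1 (fibreFamily U c (pre U c * g * post U c) i) ≤ α) →
          ϑ c U ((avOfRecord F N K j).avg (Function.update U (centralBond c) g) c) = g) ∧
      (∀ c U, ∀ v ∈ T c U, ∀ i : Idx (F.P K), dist1 (fibreFamily U c (pre U c * ϑ c U v * post U c) i) ≤ α) ∧
      (∀ c U v, jd c U v = (jac c U (ϑ c U v))⁻¹) ∧
      (∀ c U, ∀ v ∈ T c U, jd c U v ≠ 0) ∧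
      (∀ c, IsClosed {q : GaugeField (F.P K) j (SU N) × SU N | q.2 ∈ T c q.1}) ∧
      (∀ c, ContinuousOn (fun q : GaugeField (F.P K) j (SU N) × SU N => ϑ c q.1 q.2) {q : GaugeField (F.P K) j (SU N) × SU N | q.2 ∈ T c q.1}) ∧
      ContinuousOn (fun p : (PBond (F.P K) (j + 1) → SU N) × GaugeField (F.P K) j (SU N) =>
          (extend centralBond (fun c => ϑ c p.2 (p.1 c)) p.2 : GaugeField (F.P K) j (SU N)))
        {p : (PBond (F.P K) (j + 1) → SU N) × GaugeField (F.P K) j (SU N) | ∀ c, p.1 c ∈ T c p.2} ∧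
      (∀ c U, IsCompact (T c U)) ∧
      (∀ c U, ContinuousOn (jd c U) (T c U)) := by
  obtain ⟨jac, hjacm, hjac0, hfwd, hcont⟩ :=
    exists_jacobian_forwardLaws_continuousOn (P := F.P K) (N := N) (succ_le_range_of_lt hj) hα0 hα24 hα64 hαL hgap
  have hδ := deltaSU_pos (n := Fin N)
  have hαδ : α < deltaSU (Fin N) := by nlinarith
  obtain ⟨T, ϑ, jd, h1, h2, h3, h4, h5, h6, h7, h8, h9, h10, h11, h12, h13, h14, h15, h16⟩ :=
    exists_perBondCharts_of_forwardLaws_sharp (F := F) (N := N) hj hα0 hα24 hαδ hgap jac hjacm hjac0 fun c U => by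
      rw [avOfRecord_avg]
      exact hfwd c U
  have hjd : ∀ c U, ContinuousOn (jd c U) (T c U) :=
    continuousOn_inverseDensity_of_formula T ϑ jd jac h11 h10 (fun c U => (h14 c).comp (continuous_const.prodMk continuous_id).continuousOn
      fun v (hv : v ∈ T c U) => hv) hjac0 hcont
  exact ⟨jac, T, ϑ, jd, hjacm, hjac0, hcont, h1, h2, h3, h4, h5, h6, h7, h8, h9, h10, h11, h12, h13, h14, h15, h16, hjd⟩

end Summit.QuantumFields.YangMills.BalabanUVNodes.N09PerBondChartsCentralWindowSharp

end
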